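import Mathlib
import HarnessLib
import Summits.HubbardSuperconductivity.HubbardSuperconductivity.Theorems.KLProgrammeKLRegimeSplitSlotsV17F2
import Summits.HubbardSuperconductivity.HubbardSuperconductivity.Theorems.KLProgrammeKLRegimeEngineV8DefsU6

/-!
# K3 ENGINE package, `G`-level v7: the DOOR-KEYED (E4)₀ constant `klE4T6` and `klEngGeo7 := klEngGeo6.raiseE4 klE4T6`

Cell `gate-hubbard-kl`, seat hubbard-kl-k3c2-p1 g4 (row «scale-0 Gram step `stub_engine_scale0`»; FINDING (cE4-KEY), KL STATUS 2026-08-27 11:42Z).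

WHY.  The engine-flow stub (a) states (E4)₀ as `EngineFirstMoments L M klEngGeo6 P (klEngQ6 P R) β U μ K₀ 0`, whose right-hand side reads
`klEngGeo6.cE4 = max klEngGeo3.cE4 klE4T = max 2^10 klE4T` (`klEngGeo6_cE4`, `klEngGeo5_cE4`, `klEngGeo4_cE4`).  The constant `klE4T`
(`…EngineE4ConstDefs`) is the classical witness of `E4ScaleZeroAt`, which is keyed on the PRE-door thresholds `c ≤ klEngC₃3 P R`,
`U ≤ klEngU₀3 P R c`.  By finding (E4-THR) / ruling (R29) the (E4)₀ smallness is derivable only under the DOORS `klEngC₃6 ≤ klE4C₃ R`,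
`klEngU₀6 ≤ klE4U₀ R` (`…EngineV8DefsU6`): the (E4)₀ proof has the shape «`∀ G` well formed, `E₆ ≤ G.cE4` ⇒ ⟨binders with the doors⟩ ⇒
`EngineFirstMoments … G … K 0`» with `E₆` closed but NON-NUMERIC — so it witnesses the door-keyed admissibility below, not `E4ScaleZeroAt`, and
`E₆ ≤ klEngGeo6.cE4` is unprovable.  Exactly as `klEngGeo4 := klEngGeo3.raise (klIsoT^4) klE4T` absorbed the then-(E4)₀ constant, this file lets the
`cE4` slot absorb the door-keyed one, touching NO other field (so every `CF`/`S`/`bhi`/gain-reading majorant is `rfl`-unchanged):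

* §1 **`E4ScaleZeroAt6 E`** — «`E` is an admissible (E4)₀ constant UNDER THE DOORS»: for every well-formed `G` with `E ≤ G.cE4` and the binders of the
  flow stub (a) (`c ≤ klEngC₃6 P R`, `U ≤ klEngU₀6 P R c`, any admissible frame `K`), `EngineFirstMoments L M G P (klEngQ6 P R) β U μ K 0`;
  **`klE4T6`** (classical `if`, a CLOSED term), `klE4T6_nonneg`, `e4ScaleZeroAt6_klE4T6`, `E4ScaleZeroAt6.mono`, `E4ScaleZeroAt6.of_e4ScaleZeroAt`
  (the pre-door statement implies the door-keyed one), consumer `engineFirstMoments_zero_of_e4ScaleZeroAt6`;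
* §2 **`GeoConsts.raiseE4 G E := { G with cE4 := max G.cE4 E }`** — `rfl` field rows, `raiseE4_wf`, and the slot doors: every flow clause that does not
  read `cE4` is UNCHANGED (`Iff`), (E4) and the engine slot `EngineBoundsAtV17F2` lift (`0 ≤ P.Klam`);
* §3 **`klEngGeo7 := klEngGeo6.raiseE4 klE4T6`**, `klEngGeo7_wf`, `klE4T6_le_klEngGeo7_cE4`, `rfl` rows (`CF`, `S`, `SL`, `Bf`, `bhi`, gains, …), the
  consumers' inequalities carried from v6 (`klIsoT_pow_four_le_klEngGeo7_CF`, `klE4T_le_klEngGeo7_cE4`, `klS6_le_klEngGeo7_S`), and the instantiated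
  doors `…_klEngGeo7_iff_klEngGeo6` / `…_klEngGeo7_of_klEngGeo6`.

NOT provided (false by monotonicity, as for every `G`-raise): lifts of `TwoLegStepV17F2` as a whole (its two-volume rate reads the comparison
history in hypothesis position) or of `HistP klPredsV17F2 … klEngGeo7 …` hypotheses from their `klEngGeo6` versions — at `klEngGeo7` a history
differs from its `klEngGeo6` twin EXACTLY in the (E4)ⱼ clauses (§2 `engineBoundsAtV17F2_raiseE4_iff_of_E4`).  Registrant token: `klEngGeo6 ↦ klEngGeo7`
(+ `klEngGeo6_wf ↦ klEngGeo7_wf`, this import).  Definitions with bodies + order lemmas only; nothing about the model is asserted; nothing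
asserts superconductivity.
-/

noncomputable section

/-! ## §2 (generic part) `GeoConsts.raiseE4` — raising the first-moment constant alone -/

namespace Summit.HubbardSuperconductivity.HubbardSuperconductivity.Theorems.KLRegimeSplit

set_option linter.dupNamespace false -- summit = problem name (single-conjunct summit), D-0017

open Real Finset Literature.MathematicalPhysics.QuantumLattice Literature.Probability.LatticeModels
open Summit.HubbardSuperconductivity.HubbardSuperconductivity.Theorems.KLProgrammeLegKernels

/-- **`G.raiseE4 E`** — the geometric package `G` with `cE4 := max G.cE4 E`, EVERY other field (in particular `CF`) untouched. -/
def GeoConsts.raiseE4 (G : GeoConsts) (E : ℝ) : GeoConsts :=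
  { G with cE4 := max G.cE4 E }

namespace GeoConsts

variable (G : GeoConsts) (E : ℝ)

/-- `(G.raiseE4 E).cE4 = max G.cE4 E`. -/
theorem raiseE4_cE4 : (G.raiseE4 E).cE4 = max G.cE4 E := rfl
/-- untouched field `CF`. -/
theorem raiseE4_CF : (G.raiseE4 E).CF = G.CF := rfl
/-- untouched field `atop`. -/
theorem raiseE4_atop : (G.raiseE4 E).atop = G.atop := rfl
/-- untouched field `abot`. -/
theorem raiseE4_abot : (G.raiseE4 E).abot = G.abot := rfl
/-- untouched field `blo`. -/
theorem raiseE4_blo : (G.raiseE4 E).blo = G.blo := rfl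
/-- untouched field `bhi`. -/
theorem raiseE4_bhi : (G.raiseE4 E).bhi = G.bhi := rfl
/-- untouched field `cloc`. -/
theorem raiseE4_cloc : (G.raiseE4 E).cloc = G.cloc := rfl
/-- untouched field `θ`. -/
theorem raiseE4_θ : (G.raiseE4 E).θ = G.θ := rfl
/-- untouched field `a`. -/
theorem raiseE4_a : (G.raiseE4 E).a = G.a := rfl
/-- untouched field `ζ`. -/
theorem raiseE4_ζ : (G.raiseE4 E).ζ = G.ζ := rfl
/-- untouched field `Z`. -/
theorem raiseE4_Z : (G.raiseE4 E).Z = G.Z := rfl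
/-- untouched field `aplus`. -/
theorem raiseE4_aplus : (G.raiseE4 E).aplus = G.aplus := rfl
/-- untouched field `ppGain`. -/
theorem raiseE4_ppGain : (G.raiseE4 E).ppGain = G.ppGain := rfl
/-- untouched field `phGain`. -/
theorem raiseE4_phGain : (G.raiseE4 E).phGain = G.phGain := rfl
/-- untouched field `S`. -/
theorem raiseE4_S : (G.raiseE4 E).S = G.S := rfl
/-- untouched field `Bf`. -/
theorem raiseE4_Bf : (G.raiseE4 E).Bf = G.Bf := rfl
/-- untouched field `SL`. -/
theorem raiseE4_SL : (G.raiseE4 E).SL = G.SL := rfl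

/-- `G.cE4 ≤ (G.raiseE4 E).cE4`. -/
theorem cE4_le_raiseE4_cE4 : G.cE4 ≤ (G.raiseE4 E).cE4 := le_max_left _ _
/-- `E ≤ (G.raiseE4 E).cE4`. -/
theorem le_raiseE4_cE4 : E ≤ (G.raiseE4 E).cE4 := le_max_right _ _

variable {G}

/-- **Raising `cE4` preserves well-formedness** (`cE4` enters `GeoConsts.WF` only through `0 ≤ cE4`). -/
theorem raiseE4_wf (hG : G.WF) (E : ℝ) : (G.raiseE4 E).WF := by
  obtain ⟨h1, h2, h3, h4, h5, h6, h7, h8, h9, h10, h11, h12, h13, h14, h15, h16, h17, h18, h19, h20⟩ := hG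
  exact ⟨h1, h2, h3, h4, h5, h6, h7, h8, h9, h10, h11, h12, h13, h14, h15, h16, h17.trans (le_max_left _ _), h18, h19, h20⟩

end GeoConsts

/-! ### The majorants under `raiseE4`: ALL unchanged (`cE4` is read by no majorant, only by the (E4) right-hand side) -/

section Bars

variable (G : GeoConsts) (E : ℝ) (P : SplitConsts) (Q : EngConsts)

/-- `initDevBar` unchanged. -/
theorem initDevBar_raiseE4 (U : ℝ) : initDevBar (G.raiseE4 E) U = initDevBar G U := rfl
/-- `legDressBarQ2` unchanged (it does not read `G` at all). -/
theorem legDressBarQ2_raiseE4 (U : ℝ) (n c : ℕ) : legDressBarQ2 (G.raiseE4 E) P Q U n c = legDressBarQ2 G P Q U n c := rfl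
/-- `gainBar` unchanged. -/
theorem gainBar_raiseE4 (U : ℝ) (n : ℕ) (ρpp ρd ρx : ℝ) : gainBar (G.raiseE4 E) P U n ρpp ρd ρx = gainBar G P U n ρpp ρd ρx := rfl
/-- `eremBar` unchanged. -/
theorem eremBar_raiseE4 (U β : ℝ) (L n : ℕ) : eremBar (G.raiseE4 E) P Q U β L n = eremBar G P Q U β L n := rfl
/-- `drivePBar` unchanged. -/
theorem drivePBar_raiseE4 (U : ℝ) (n : ℕ) : drivePBar (G.raiseE4 E) P U n = drivePBar G P U n := rfl
/-- `klEdge` unchanged. -/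
theorem klEdge_raiseE4 (n : ℕ) (ρ : ℝ) : klEdge (G.raiseE4 E) n ρ = klEdge G n ρ := rfl
/-- **`thermalBar` unchanged** (it reads `CF`, which `raiseE4` does not touch — the point of raising `cE4` alone). -/
theorem thermalBar_raiseE4 (U β : ℝ) (n : ℕ) : thermalBar (G.raiseE4 E) P U β n = thermalBar G P U β n := rfl

end Bars

/-! ### The flow slot clauses under `raiseE4` -/

section Model

variable {L M : ℕ} [NeZero L] [NeZero M] {G : GeoConsts} {P : SplitConsts} {Q : EngConsts} {R : RenConsts} {β U μ : ℝ}
  {K : TrigPolyC4v} {n : ℕ} (E : ℝ)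

/-- **(E2-F2) is unchanged by `raiseE4`.** -/
theorem pairLadderStepAtV17F2_raiseE4_iff :
    PairLadderStepAtV17F2 L M (G.raiseE4 E) P Q β U μ n ↔ PairLadderStepAtV17F2 L M G P Q β U μ n := Iff.rfl

/-- (E2-F) (rev-1 token) is unchanged by `raiseE4`. -/
theorem pairLadderStepAtV17F_raiseE4_iff :
    PairLadderStepAtV17F L M (G.raiseE4 E) P Q β U μ n ↔ PairLadderStepAtV17F L M G P Q β U μ n := Iff.rfl

/-- **(E2″-F) is unchanged by `raiseE4`.** -/
theorem pairValueIncrementAtV17F_raiseE4_iff :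
    PairValueIncrementAtV17F L M (G.raiseE4 E) P Q β U μ n ↔ PairValueIncrementAtV17F L M G P Q β U μ n := Iff.rfl

/-- **(E2′-F) is unchanged by `raiseE4`.** -/
theorem quarticValueIncrementAtV17F_raiseE4_iff :
    QuarticValueIncrementAtV17F L M (G.raiseE4 E) P Q β U μ n ↔ QuarticValueIncrementAtV17F L M G P Q β U μ n := Iff.rfl

/-- **(E2′-F UV) is unchanged by `raiseE4`.** -/
theorem quarticValueUVAtV17F_raiseE4_iff :
    QuarticValueUVAtV17F L M (G.raiseE4 E) P Q β U μ n ↔ QuarticValueUVAtV17F L M G P Q β U μ n := Iff.rfl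

/-- **(E5-F) is unchanged by `raiseE4`** (it reads `CF`, untouched). -/
theorem isoTupleL1AtV17F_raiseE4_iff :
    IsoTupleL1AtV17F L M (G.raiseE4 E) P β U μ n ↔ IsoTupleL1AtV17F L M G P β U μ n := Iff.rfl

/-- The split slot does not read `G`. -/
theorem betaSplitAtV17F_raiseE4_iff :
    BetaSplitAtV17F L M (G.raiseE4 E) P Q β U μ n ↔ BetaSplitAtV17F L M G P Q β U μ n := Iff.rfl

/-- (E3a-F) reads only `G.S` (untouched). -/
theorem twoLegReadJetsF_raiseE4_iff :
    TwoLegReadJetsF L M (G.raiseE4 E) Q β U μ n ↔ TwoLegReadJetsF L M G Q β U μ n := Iff.rfl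

/-- **(E4) lifts along `raiseE4`** (`0 ≤ P.Klam`; monotone in `cE4`). -/
theorem engineFirstMoments_raiseE4_of (hK : 0 ≤ P.Klam) (h : EngineFirstMoments L M G P Q β U μ K n) :
    EngineFirstMoments L M (G.raiseE4 E) P Q β U μ K n :=
  engineFirstMoments_mono (G.cE4_le_raiseE4_cE4 E) hK h

/-- **The cured engine slot lifts along `raiseE4`** (`0 ≤ P.Klam`): only its (E4) conjunct moves, monotonically. -/
theorem engineBoundsAtV17F2_raiseE4_of (hK : 0 ≤ P.Klam) (h : EngineBoundsAtV17F2 L M G P Q β U μ n) :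
    EngineBoundsAtV17F2 L M (G.raiseE4 E) P Q β U μ n := by
  obtain ⟨h0, h1, h2, h3, h4, h5, h6, h7⟩ := h
  exact ⟨h0, h1, h2, h3, h4, h5, engineFirstMoments_raiseE4_of E hK h6, h7⟩

/-- **At the raised package the engine slot is the unraised one with (E4) re-read at the larger `cE4`**: the seven other conjuncts are
literally the same propositions — what a `klEngGeo7`-history gives a `klEngGeo6`-keyed consumer. -/
theorem engineBoundsAtV17F2_raiseE4_iff_of_E4 :
    EngineBoundsAtV17F2 L M (G.raiseE4 E) P Q β U μ n ↔
      (SelfEnergySymmetric L M β U μ (klFlowFrameU L M β U μ n) n ∧ KernelNormsV4 L M P Q β U μ (klFlowFrameU L M β U μ n) n ∧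
        PairLadderStepAtV17F2 L M G P Q β U μ n ∧ PairValueIncrementAtV17F L M G P Q β U μ n ∧
          QuarticValueIncrementAtV17F L M G P Q β U μ n ∧ QuarticValueUVAtV17F L M G P Q β U μ n ∧
            EngineFirstMoments L M (G.raiseE4 E) P Q β U μ (klFlowFrameU L M β U μ n) n ∧ IsoTupleL1AtV17F L M G P β U μ n) :=
  Iff.rfl

end Model

end Summit.HubbardSuperconductivity.HubbardSuperconductivity.Theorems.KLRegimeSplit

namespace Summit.HubbardSuperconductivity.HubbardSuperconductivity.Theorems.EngineV8

set_option linter.dupNamespace false -- summit = problem name (single-conjunct summit), D-0017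

open Real Finset Literature.MathematicalPhysics.QuantumLattice Literature.Probability.LatticeModels
open Summit.HubbardSuperconductivity.HubbardSuperconductivity.Theorems.KLRegimeSplit
open Summit.HubbardSuperconductivity.HubbardSuperconductivity.Theorems.KLProgrammeLegKernels

/-! ## §1 The door-keyed (E4)₀ admissibility `E4ScaleZeroAt6` and the closed constant `klE4T6` -/

/-- **`E4ScaleZeroAt6 E`** — `E` is an admissible (E4)₀ constant UNDER THE DOORS of the engine-flow package: for every well-formed `G` with
`E ≤ G.cE4`, every `P`, `R`, `c` with `c ≤ klEngC₃6 P R`, every `U ≤ klEngU₀6 P R c`, `klBetaMin ≤ β ≤ e^{c/U²}`, every admissible frame `K`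
(`FrameOK R U (nScales β) μ K` — in the flow child `K = K₀ = 0`), and the volumes above `klEngL₃ / klEngM₃`:
`EngineFirstMoments L M G P (klEngQ6 P R) β U μ K 0`.  (Twin of `E4ScaleZeroAt` with `klEngC₃3 ↦ klEngC₃6`, `klEngU₀3 ↦ klEngU₀6`, `klEngQ5 ↦ klEngQ6`.)
WITNESS SHAPE (plan g17 (R33)(i)): `E` is bound BEFORE `G`, `P`, `R`, `c`, `U`, `β`, `K`, `L`, `M` — an admissible constant is a CLOSED ABSOLUTE term
(e.g. built from `klIsoT`, `klCutSqB5`, `klAngWA`, `klE4X0`); every `R`-, `c`- or `U`-dependent part of a first-moment bound must be absorbed under the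
doors `klEngC₃6 P R ≤ klE4C₃ R`, `klEngU₀6 P R c ≤ klE4U₀ R` (or into the `Q.cE4·|U|` term of the clause), never into `E`. -/
def E4ScaleZeroAt6 (E : ℝ) : Prop :=
  ∀ (G : GeoConsts), G.WF → E ≤ G.cE4 →
    ∀ (P : SplitConsts) (R : RenConsts) (c : ℝ), P.WF → R.WF2 → 0 < c → c ≤ klEngC₃6 P R → ∀ μ ∈ klWindowC, ∀ U : ℝ, 0 < U →
    U ≤ klEngU₀6 P R c → ∀ β : ℝ, klBetaMin ≤ β → β ≤ Real.exp (c / U ^ 2) → ∀ K : TrigPolyC4v, FrameOK R U (nScales β) μ K →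
    ∀ (L M : ℕ) [NeZero L] [NeZero M], klEngL₃ β U ≤ L → klEngM₃ β U L ≤ M → EngineFirstMoments L M G P (klEngQ6 P R) β U μ K 0

open Classical in
/-- **`klE4T6`** — THE door-keyed (E4)₀ constant of the engine-flow package: a nonnegative admissible constant when one exists, `0` otherwise
(a closed term; it enters the `G`-package as `cE4 := max klEngGeo6.cE4 klE4T6`). -/
def klE4T6 : ℝ := if h : (∃ E : ℝ, 0 ≤ E ∧ E4ScaleZeroAt6 E) then Classical.choose h else 0

/-- `0 ≤ klE4T6`. -/
theorem klE4T6_nonneg : 0 ≤ klE4T6 := by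
  classical
  unfold klE4T6
  split_ifs with h
  · exact (Classical.choose_spec h).1
  · exact le_rfl

/-- **`klE4T6` is admissible as soon as any nonnegative constant is** (the form in which the (E4)₀ packager's theorem is consumed). -/
theorem e4ScaleZeroAt6_klE4T6 {E : ℝ} (hE0 : 0 ≤ E) (hE : E4ScaleZeroAt6 E) : E4ScaleZeroAt6 klE4T6 := by
  classical
  have h : ∃ E : ℝ, 0 ≤ E ∧ E4ScaleZeroAt6 E := ⟨E, hE0, hE⟩
  have : klE4T6 = Classical.choose h := by unfold klE4T6; exact dif_pos h
  rw [this]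
  exact (Classical.choose_spec h).2

/-- A larger constant is still admissible. -/
theorem E4ScaleZeroAt6.mono {E E' : ℝ} (h : E4ScaleZeroAt6 E) (hEE' : E ≤ E') : E4ScaleZeroAt6 E' :=
  fun G hG hE' => h G hG (hEE'.trans hE')

/-- **The pre-door admissibility implies the door-keyed one** (`klEngC₃6 ≤ klEngC₃3`, `klEngU₀6 ≤ klEngU₀3`; (E4) reads `Q.cE4` only and
`(klEngQ6 P R).cE4 = (klEngQ5 P R).cE4`): any witness of `E4ScaleZeroAt E` is a witness of `E4ScaleZeroAt6 E`. -/
theorem E4ScaleZeroAt6.of_e4ScaleZeroAt {E : ℝ} (h : E4ScaleZeroAt E) : E4ScaleZeroAt6 E := by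
  intro G hG hE P R c hP hR hc hc₆ μ hμ U hU hU₀ β hβ hβc K hK L M _ _ hL hM
  exact (engineFirstMoments_raiseCE_iff (klCE6 P R) (klS6' P R)).2
    (h G hG hE P R c hP hR hc (hc₆.trans (klEngC₃6_le_klEngC₃3 P R)) μ hμ U hU (hU₀.trans (klEngU₀6_le_klEngU₀3 P R c)) β hβ hβc K
      hK L M hL hM)

/-- **Consumer form**: from any witness `E4ScaleZeroAt6 E` (`0 ≤ E`), at every well-formed `G` with `klE4T6 ≤ G.cE4`, under the binders of the
flow stub (a) (any admissible frame `K`), `EngineFirstMoments L M G P (klEngQ6 P R) β U μ K 0`. -/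
theorem engineFirstMoments_zero_of_e4ScaleZeroAt6 {E : ℝ} (hE0 : 0 ≤ E) (hE : E4ScaleZeroAt6 E) (G : GeoConsts) (hG : G.WF)
    (hcE4 : klE4T6 ≤ G.cE4) (P : SplitConsts) (R : RenConsts) (c : ℝ) (hP : P.WF) (hR : R.WF2) (hc : 0 < c) (hc₆ : c ≤ klEngC₃6 P R)
    (μ : ℝ) (hμ : μ ∈ klWindowC) (U : ℝ) (hU : 0 < U) (hU₀ : U ≤ klEngU₀6 P R c) (β : ℝ) (hβ : klBetaMin ≤ β)
    (hβc : β ≤ Real.exp (c / U ^ 2)) (K : TrigPolyC4v) (hK : FrameOK R U (nScales β) μ K) (L M : ℕ) [NeZero L] [NeZero M]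
    (hL : klEngL₃ β U ≤ L) (hM : klEngM₃ β U L ≤ M) : EngineFirstMoments L M G P (klEngQ6 P R) β U μ K 0 :=
  e4ScaleZeroAt6_klE4T6 hE0 hE G hG hcE4 P R c hP hR hc hc₆ μ hμ U hU hU₀ β hβ hβc K hK L M hL hM

/-! ## §3 The package `klEngGeo7` -/

/-- **`klEngGeo7` — the engine-flow package's absolute constants `G`, v7**: `klEngGeo6` with `cE4 := max klEngGeo6.cE4 klE4T6`, NOTHING else moved. -/
def klEngGeo7 : GeoConsts := klEngGeo6.raiseE4 klE4T6

/-- `klEngGeo7 = klEngGeo6.raiseE4 klE4T6` (`rfl`; the form the `_raiseE4` doors consume). -/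
theorem klEngGeo7_eq : klEngGeo7 = klEngGeo6.raiseE4 klE4T6 := rfl

/-- **`klEngGeo7` is well formed.** -/
theorem klEngGeo7_wf : klEngGeo7.WF := GeoConsts.raiseE4_wf klEngGeo6_wf _

/-- `klEngGeo7.cE4 = max klEngGeo6.cE4 klE4T6`. -/
theorem klEngGeo7_cE4 : klEngGeo7.cE4 = max klEngGeo6.cE4 klE4T6 := rfl

/-- **`klE4T6 ≤ klEngGeo7.cE4`** — the `hcE4` input of the door-keyed (E4)₀ consumer form at the v7 package. -/
theorem klE4T6_le_klEngGeo7_cE4 : klE4T6 ≤ klEngGeo7.cE4 := le_max_right _ _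

/-- `klEngGeo6.cE4 ≤ klEngGeo7.cE4`. -/
theorem klEngGeo6_cE4_le_klEngGeo7_cE4 : klEngGeo6.cE4 ≤ klEngGeo7.cE4 := le_max_left _ _

/-- `klE4T ≤ klEngGeo7.cE4` (the pre-door constant still rides). -/
theorem klE4T_le_klEngGeo7_cE4 : klE4T ≤ klEngGeo7.cE4 := klE4T_le_klEngGeo6_cE4.trans klEngGeo6_cE4_le_klEngGeo7_cE4

/-- untouched field `CF`. -/
theorem klEngGeo7_CF : klEngGeo7.CF = klEngGeo6.CF := rfl
/-- **`klIsoT ^ 4 ≤ klEngGeo7.CF`** — the (E5)₀ consumer's input survives (`CF` untouched). -/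
theorem klIsoT_pow_four_le_klEngGeo7_CF : klIsoT ^ 4 ≤ klEngGeo7.CF := klIsoT_pow_four_le_klEngGeo6_CF
/-- untouched field `S`. -/
theorem klEngGeo7_S : klEngGeo7.S = klEngGeo6.S := rfl
/-- `klS6 j ≤ klEngGeo7.S j` (the two-leg table inequality of v6 survives). -/
theorem klS6_le_klEngGeo7_S (j : ℕ) : klS6 j ≤ klEngGeo7.S j := klS6_le_klEngGeo6_S j
/-- untouched field `SL`. -/
theorem klEngGeo7_SL : klEngGeo7.SL = klEngGeo6.SL := rfl
/-- untouched field `Bf`. -/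
theorem klEngGeo7_Bf : klEngGeo7.Bf = klEngGeo6.Bf := rfl
/-- untouched field `bhi`. -/
theorem klEngGeo7_bhi : klEngGeo7.bhi = klEngGeo6.bhi := rfl
/-- untouched field `blo`. -/
theorem klEngGeo7_blo : klEngGeo7.blo = klEngGeo6.blo := rfl
/-- untouched field `ppGain`. -/
theorem klEngGeo7_ppGain : klEngGeo7.ppGain = klEngGeo6.ppGain := rfl
/-- untouched field `phGain`. -/
theorem klEngGeo7_phGain : klEngGeo7.phGain = klEngGeo6.phGain := rfl
/-- untouched field `aplus`. -/
theorem klEngGeo7_aplus : klEngGeo7.aplus = klEngGeo6.aplus := rfl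
/-- untouched field `ζ`. -/
theorem klEngGeo7_ζ : klEngGeo7.ζ = klEngGeo6.ζ := rfl
/-- untouched field `Z`. -/
theorem klEngGeo7_Z : klEngGeo7.Z = klEngGeo6.Z := rfl
/-- untouched field `cloc`. -/
theorem klEngGeo7_cloc : klEngGeo7.cloc = klEngGeo6.cloc := rfl
/-- untouched field `θ`. -/
theorem klEngGeo7_θ : klEngGeo7.θ = klEngGeo6.θ := rfl
/-- untouched field `a`. -/
theorem klEngGeo7_a : klEngGeo7.a = klEngGeo6.a := rfl
/-- untouched field `atop`. -/
theorem klEngGeo7_atop : klEngGeo7.atop = klEngGeo6.atop := rfl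
/-- untouched field `abot`. -/
theorem klEngGeo7_abot : klEngGeo7.abot = klEngGeo6.abot := rfl

/-- `thermalBar klEngGeo7 = thermalBar klEngGeo6` (`CF` untouched). -/
theorem thermalBar_klEngGeo7 (P : SplitConsts) (U β : ℝ) (n : ℕ) : thermalBar klEngGeo7 P U β n = thermalBar klEngGeo6 P U β n := rfl

/-! ### The instantiated doors `klEngGeo6 ⟷ klEngGeo7` -/

section Model

variable {L M : ℕ} [NeZero L] [NeZero M] {P : SplitConsts} {Q : EngConsts} {R : RenConsts} {β U μ : ℝ} {K : TrigPolyC4v} {n : ℕ}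

/-- (E2-F2) at `klEngGeo7` IS (E2-F2) at `klEngGeo6`. -/
theorem pairLadderStepAtV17F2_klEngGeo7_iff :
    PairLadderStepAtV17F2 L M klEngGeo7 P Q β U μ n ↔ PairLadderStepAtV17F2 L M klEngGeo6 P Q β U μ n := Iff.rfl
/-- (E2″-F) at `klEngGeo7` IS (E2″-F) at `klEngGeo6`. -/
theorem pairValueIncrementAtV17F_klEngGeo7_iff :
    PairValueIncrementAtV17F L M klEngGeo7 P Q β U μ n ↔ PairValueIncrementAtV17F L M klEngGeo6 P Q β U μ n := Iff.rfl
/-- (E2′-F) at `klEngGeo7` IS (E2′-F) at `klEngGeo6`. -/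
theorem quarticValueIncrementAtV17F_klEngGeo7_iff :
    QuarticValueIncrementAtV17F L M klEngGeo7 P Q β U μ n ↔ QuarticValueIncrementAtV17F L M klEngGeo6 P Q β U μ n := Iff.rfl
/-- (E2′-F UV) at `klEngGeo7` IS (E2′-F UV) at `klEngGeo6`. -/
theorem quarticValueUVAtV17F_klEngGeo7_iff :
    QuarticValueUVAtV17F L M klEngGeo7 P Q β U μ n ↔ QuarticValueUVAtV17F L M klEngGeo6 P Q β U μ n := Iff.rfl
/-- (E5-F) at `klEngGeo7` IS (E5-F) at `klEngGeo6`. -/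
theorem isoTupleL1AtV17F_klEngGeo7_iff :
    IsoTupleL1AtV17F L M klEngGeo7 P β U μ n ↔ IsoTupleL1AtV17F L M klEngGeo6 P β U μ n := Iff.rfl
/-- (E3a-F) at `klEngGeo7` IS (E3a-F) at `klEngGeo6`. -/
theorem twoLegReadJetsF_klEngGeo7_iff :
    TwoLegReadJetsF L M klEngGeo7 Q β U μ n ↔ TwoLegReadJetsF L M klEngGeo6 Q β U μ n := Iff.rfl
/-- The split slot at `klEngGeo7` IS the split slot at `klEngGeo6`. -/
theorem betaSplitAtV17F_klEngGeo7_iff :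
    BetaSplitAtV17F L M klEngGeo7 P Q β U μ n ↔ BetaSplitAtV17F L M klEngGeo6 P Q β U μ n := Iff.rfl

/-- **(E4) lifts `klEngGeo6 → klEngGeo7`** (`0 ≤ P.Klam`). -/
theorem engineFirstMoments_klEngGeo7_of_klEngGeo6 (hK : 0 ≤ P.Klam) (h : EngineFirstMoments L M klEngGeo6 P Q β U μ K n) :
    EngineFirstMoments L M klEngGeo7 P Q β U μ K n :=
  engineFirstMoments_raiseE4_of klE4T6 hK h

/-- **The cured engine slot lifts `klEngGeo6 → klEngGeo7`** (`0 ≤ P.Klam`). -/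
theorem engineBoundsAtV17F2_klEngGeo7_of_klEngGeo6 (hK : 0 ≤ P.Klam) (h : EngineBoundsAtV17F2 L M klEngGeo6 P Q β U μ n) :
    EngineBoundsAtV17F2 L M klEngGeo7 P Q β U μ n :=
  engineBoundsAtV17F2_raiseE4_of klE4T6 hK h

/-- **What a `klEngGeo7` engine slot gives a `klEngGeo6`-keyed consumer**: every conjunct except (E4) verbatim at `klEngGeo6`, and (E4) at `klEngGeo7`. -/
theorem engineBoundsAtV17F2_klEngGeo7_iff_of_E4 :
    EngineBoundsAtV17F2 L M klEngGeo7 P Q β U μ n ↔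
      (SelfEnergySymmetric L M β U μ (klFlowFrameU L M β U μ n) n ∧ KernelNormsV4 L M P Q β U μ (klFlowFrameU L M β U μ n) n ∧
        PairLadderStepAtV17F2 L M klEngGeo6 P Q β U μ n ∧ PairValueIncrementAtV17F L M klEngGeo6 P Q β U μ n ∧
          QuarticValueIncrementAtV17F L M klEngGeo6 P Q β U μ n ∧ QuarticValueUVAtV17F L M klEngGeo6 P Q β U μ n ∧
            EngineFirstMoments L M klEngGeo7 P Q β U μ (klFlowFrameU L M β U μ n) n ∧ IsoTupleL1AtV17F L M klEngGeo6 P β U μ n) :=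
  Iff.rfl

/-- **The (E4)₀ conjunct of the flow stub (a) at `klEngGeo7` from ANY door-keyed witness** — the closer's one-liner once the (E4)₀ packager
lands `E4ScaleZeroAt6 E₆`: under exactly the stub's binders (frame `K₀ = klFlowFrameU L M β U μ 0` or any admissible `K`),
`EngineFirstMoments L M klEngGeo7 P (klEngQ6 P R) β U μ K 0`. -/
theorem engineFirstMoments_zero_klEngGeo7_of_e4ScaleZeroAt6 {E : ℝ} (hE0 : 0 ≤ E) (hE : E4ScaleZeroAt6 E) (P : SplitConsts)
    (R : RenConsts) (c : ℝ) (hP : P.WF) (hR : R.WF2) (hc : 0 < c) (hc₆ : c ≤ klEngC₃6 P R) (μ : ℝ) (hμ : μ ∈ klWindowC) (U : ℝ)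
    (hU : 0 < U) (hU₀ : U ≤ klEngU₀6 P R c) (β : ℝ) (hβ : klBetaMin ≤ β) (hβc : β ≤ Real.exp (c / U ^ 2)) (K : TrigPolyC4v)
    (hK : FrameOK R U (nScales β) μ K) (L M : ℕ) [NeZero L] [NeZero M] (hL : klEngL₃ β U ≤ L) (hM : klEngM₃ β U L ≤ M) :
    EngineFirstMoments L M klEngGeo7 P (klEngQ6 P R) β U μ K 0 :=
  engineFirstMoments_zero_of_e4ScaleZeroAt6 hE0 hE klEngGeo7 klEngGeo7_wf klE4T6_le_klEngGeo7_cE4 P R c hP hR hc hc₆ μ hμ U hU hU₀ β hβ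
    hβc K hK L M hL hM

end Model

end Summit.HubbardSuperconductivity.HubbardSuperconductivity.Theorems.EngineV8

end
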